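import Summits.ResolutionOfSingularities.ResolutionOfSingularities.Theorems.FrobeniusLadderFRationalResolutionConeChartEntry
import HarnessLib

/-!
# Crux `FrobeniusLadder.FRationalResolution` (stmt-ResolutionOfSingularities-15317), line `redirect`,
# stub `stub_diagonalizableQuotientResolution` — **round 0 along a rank-2 stratum of ANY dimension: a singular point
# under a sharp rank-two log regular chart is a cone chart algebra point in normal form** (design C3 = the rank-2
# stratum layer of the non-isolated case, memo MEMO-15317-leafhand2-g10 §2 (L4, entry): lineage 2's
# `…ConeChartEntry.exists_normalForm_of_not_isRegularLocalRing` WITHOUT the hypothesis `dim A_𝔭 ≤ 2`)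

DATA: a Noetherian ring `A`, a prime `𝔭` (the stratum through `𝔭` may have any dimension), a chart `φ : P → A`,
`P ⊆ ℤ²` finitely generated, saturated and spanning, log regular at `𝔭` with UNIT FACE `0` — the shape produced at a
rank-2 stratum point by `…IsolatedQuotientResolution.exists_sharp_affine_chart`. RESULTS:
* **`exists_normalForm_of_not_isRegularLocalRing_of_stratum`** — if `A_𝔭` is NOT regular then, in a `ℤ`-basis `(u, e)`,
  `P = ℤF_𝔭 + {m u + l e : l ≥ 0, a l ≤ d m}` with `0 < a < d` — exactly the hypotheses `hQ`/`hind`/`hspan` of the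
  ring-level round `…ConeChainCharts.round_charts` for `(C, Q, χ) = (A, P, φ)`, with measure `d`;
* `rank_bound_of_face_zero` — the rank bound `2 − rk F_𝔭 ≤ 2` (trivially) in the form consumed by
  `…FixedStratumNextRound` / `…FixedStratumBlowupPoints` (`hrank`).
The two dimension conclusions of the surface version (`I(𝔭)A_𝔭 = 𝔪_{A_𝔭}`, `dim A_𝔭 = 2`) are dropped: along a
positive-dimensional stratum they are false, and the positive-dimensional recursion (`…FixedStratum*`) does not use
them.

Honest label: assembly toward ONE leaf stub (no stub, crux or summit closed). No definitions, no named facts, no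
sorry. [cite: Kato1994, Def. (2.1), (10.1), (10.3)] [cite: Fulton1993Toric, §2.2]
-/

noncomputable section

-- single-problem summit: the doubled namespace component is forced
set_option linter.dupNamespace false

open IsLocalRing Literature.AlgebraicGeometry.Resolution Literature.AlgebraicGeometry.Resolution.LogChart
open Summit.ResolutionOfSingularities.ResolutionOfSingularities.Theorems.FRationalResolution.ConeChartEntry

namespace Summit.ResolutionOfSingularities.ResolutionOfSingularities.Theorems.FRationalResolution.FixedStratumEntry

universe u

variable {A : Type u} [CommRing A] [IsNoetherianRing A]

/-- **Normal form at a singular rank-2 stratum point (any stratum dimension).** See the module docstring.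
[cite: Kato1994, Def. (2.1), (10.1), (10.3)] [cite: Fulton1993Toric, §2.2] -/
theorem exists_normalForm_of_not_isRegularLocalRing_of_stratum {P : AddSubmonoid (Fin 2 → ℤ)}
    {φ : Multiplicative P →* A} {𝔭 : Ideal A} [𝔭.IsPrime] (hP : P.FG)
    (hsat : ∀ (w : Fin 2 → ℤ) (k : ℕ), 0 < k → k • w ∈ P → w ∈ P)
    (hspanP : Submodule.span ℤ (P : Set (Fin 2 → ℤ)) = ⊤)
    (hreg : IsLogRegularAt P φ 𝔭) (hface : ∀ p : P, (p : Fin 2 → ℤ) ≠ 0 → φ (Multiplicative.ofAdd p) ∈ 𝔭)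
    (hsing : ¬ IsRegularLocalRing (Localization.AtPrime 𝔭)) :
    ∃ (u e : Fin 2 → ℤ) (d a : ℕ), 0 < a ∧ a < d ∧
      (∀ g ∈ Submodule.span ℤ (faceMonoid P φ 𝔭 : Set (Fin 2 → ℤ)), ∀ m l : ℤ,
        g + m • u + l • e = 0 → m = 0 ∧ l = 0) ∧
      (∀ w : Fin 2 → ℤ, ∃ g ∈ Submodule.span ℤ (faceMonoid P φ 𝔭 : Set (Fin 2 → ℤ)),
        ∃ m l : ℤ, w = g + m • u + l • e) ∧
      (∀ w, w ∈ P ↔ ∃ g ∈ Submodule.span ℤ (faceMonoid P φ 𝔭 : Set (Fin 2 → ℤ)), ∃ m l : ℤ,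
        0 ≤ l ∧ (a : ℤ) * l ≤ (d : ℤ) * m ∧ w = g + m • u + l • e) := by
  have hL := span_faceMonoid_eq_bot (P := P) (φ := φ) (𝔭 := 𝔭) hface
  obtain ⟨u, e, d, a, had, hind, hspan, hmem⟩ :=
    ConeNormalForm.exists_normalForm P hP hsat hspanP (sharp_of_face_zero hface)
  -- the `ℤF_𝔭`-forms (`ℤF_𝔭 = 0`)
  have hindL : ∀ g ∈ Submodule.span ℤ (faceMonoid P φ 𝔭 : Set (Fin 2 → ℤ)), ∀ m l : ℤ,
      g + m • u + l • e = 0 → m = 0 ∧ l = 0 := by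
    intro g hg m l h
    rw [hL g hg, zero_add] at h
    exact hind m l h
  have hspanL : ∀ w : Fin 2 → ℤ, ∃ g ∈ Submodule.span ℤ (faceMonoid P φ 𝔭 : Set (Fin 2 → ℤ)),
      ∃ m l : ℤ, w = g + m • u + l • e := by
    intro w
    obtain ⟨m, l, rfl⟩ := hspan w
    exact ⟨0, Submodule.zero_mem _, m, l, by rw [zero_add]⟩
  have hmemL : ∀ w, w ∈ P ↔ ∃ g ∈ Submodule.span ℤ (faceMonoid P φ 𝔭 : Set (Fin 2 → ℤ)), ∃ m l : ℤ,
      0 ≤ l ∧ (a : ℤ) * l ≤ (d : ℤ) * m ∧ w = g + m • u + l • e := by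
    intro w
    rw [hmem w]
    constructor
    · rintro ⟨m, l, hl, hml, rfl⟩
      exact ⟨0, Submodule.zero_mem _, m, l, hl, hml, by rw [zero_add]⟩
    · rintro ⟨g, hg, m, l, hl, hml, rfl⟩
      exact ⟨m, l, hl, hml, by rw [hL g hg, zero_add]⟩
  -- `a ≠ 0`: the free cone would make `A_𝔭` regular (dimension-free)
  have ha : 0 < a := by
    rcases Nat.eq_zero_or_pos a with h | h
    · exfalso
      subst h
      have hdpos : (0 : ℤ) < d := by exact_mod_cast had
      refine hsing (isRegularLocalRing_of_free hP hsat hspanP hindL hspanL (fun w => ?_) hreg)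
      rw [hmemL w]
      constructor
      · rintro ⟨g, hg, m, l, hl, hml, rfl⟩
        refine ⟨g, hg, m, l, ?_, hl, rfl⟩
        simp only [Nat.cast_zero, zero_mul] at hml
        nlinarith
      · rintro ⟨g, hg, m, l, hm, hl, rfl⟩
        exact ⟨g, hg, m, l, hl, by simp only [Nat.cast_zero, zero_mul]; positivity, rfl⟩
    · exact h
  exact ⟨u, e, d, a, ha, had, hindL, hspanL, hmemL⟩

omit [IsNoetherianRing A] in
/-- **The rank bound `hrank` at a unit-face-`0` point of a rank-two chart**: `2 − rk_ℤ ℤF_𝔭 ≤ 2`. (Trivial, recorded in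
the exact form consumed by `…FixedStratumNextRound.exists_fixedPrime_package_of_stratum`.) [folklore] -/
theorem rank_bound_of_face_zero {P : AddSubmonoid (Fin 2 → ℤ)} {φ : Multiplicative P →* A} {𝔭 : Ideal A}
    [𝔭.IsPrime] : 2 - Module.finrank ℤ (Submodule.span ℤ (faceMonoid P φ 𝔭 : Set (Fin 2 → ℤ))) ≤ 2 :=
  Nat.sub_le 2 _

end Summit.ResolutionOfSingularities.ResolutionOfSingularities.Theorems.FRationalResolution.FixedStratumEntry

end
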